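import Literature.NumberTheory.Sieve.CubicMinorantDefs
import Literature.NumberTheory.Sieve.PolynomialValuesSieveBounds
import Literature.NumberTheory.Sieve.BatemanHornProofs
import Mathlib.Analysis.SpecialFunctions.Pow.Asymptotics
import HarnessLib

/-!
# The binary fundamental-lemma count for the rough model of the primes, PROVED

Topic `Literature/NumberTheory/Sieve`, namespace `Literature.NumberTheory.Sieve.CubicMinorant` (the rough
model `g_z(n) = (P(z)/φ(P(z)))·1[(n, P(z)) = 1]`, `z = (log N)^B`, `P(z) = ∏_{p<z} p`, is the tree's
`roughModel`, `CubicMinorantDefs.lean`). Statement (`RoughModelPairCountLower`, verbatim the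
parity-ideate cell's Line-E block E6) and PROOF (`roughModelPairCountLower_holds`, `c₀ = 1/16`):

  for `z = (log N)^B`, even `m ∈ [N/4, N]` and `N ≥ N₀(B)`:  `∑_{1 ≤ n < m} g_z(n) g_z(m − n) ≥ c₀ m`.

This is the classical lower bound for the number of `n < m` with `n(m − n)` free of prime factors `< z`
— the sieve main term of the binary Goldbach problem at a small sifting level — obtained from the
two-sided FUNDAMENTAL LEMMA [Greaves2001, §3.3; HalberstamRichert1974, Theorem 2.5] for the polynomial
sequence `f_m(n) = n(m − n)` (sieve dimension `2`: `ω(p) ≤ 2`, `ω(2) ≤ 1` for even `m`), in the tree's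
form `Literature.NumberTheory.Sieve.abs_card_coprime_sub_le` (`PolynomialValuesSieveBounds.lean`), with
`D = z^{s₀}` for a constant `s₀` making the fundamental-lemma factor `C_ω e^{−s₀} ≤ 1/2`, together with
the elementary bounds `(P/φ(P))²·V(z) ≥ ∏_{p≥3}(1 − (p−1)^{−2})·(truncated) ≥ 1/2`
(`half_le_sq_mul_prod`, telescoping), `P/φ(P) ≤ z` (`primesProdBelow_div_totient_le`) and
`(log N)^{B(s₀+4)} = o(N)`.

Provenance: text = section "E6 PROVED" of the cell evidence file
`run/shared/lean/pub/parity-ideate/parity-ideate-p2/evidence/LineEFG_tree.lean` (planner seat p2,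
2026-08-25, sha256 f7029116…, refereed PASS—KERNEL; statements unchanged, helpers privatised, tags
added), landed by the cell's literature seat.

## References
* [Greaves2001] G. Greaves, *Sieves in Number Theory*, Springer 2001, §3.3 (the fundamental lemma and
  its Corollary 1.1 for sifted sequences).
* [HalberstamRichert1974] H. Halberstam, H.-E. Richert, *Sieve Methods*, Academic Press 1974,
  Theorem 2.5 (fundamental lemma), §1.4 (the products `V(z)`, `P/φ(P)`).
-/

noncomputable section

open scoped ArithmeticFunction
open Finset MeasureTheory Filter Polynomial Literature.NumberTheory.Sieve

namespace Literature.NumberTheory.Sieve.CubicMinorant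

/-- **The rough-model pair count** (statement; PROVED below as `roughModelPairCountLower_holds`).
For `z = (log N)^B` and even `m ∈ [N/4, N]`, `N ≥ N₀(B)`: `∑_{1 ≤ n < m} g_z(n) g_z(m − n) ≥ c₀ m` with an
absolute `c₀ > 0` — the fundamental lemma for the sequence `n(m − n)`, dimension `2`, small level.
Verbatim the cell's Line-E block E6. [cite: Greaves2001, §3.3 (the fundamental lemma applied to a sifted sequence; Corollary 1.1)] -/
def RoughModelPairCountLower : Prop :=
  ∀ B : ℝ, 0 < B → ∃ c₀ : ℝ, 0 < c₀ ∧ ∃ N₀ : ℕ, ∀ N : ℕ, N₀ ≤ N → ∀ m : ℕ, Even m →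
    (N : ℝ) / 4 ≤ m → m ≤ N →
      c₀ * (m : ℝ) ≤ ∑ n ∈ Icc 1 (m - 1), roughModel B N n * roughModel B N (m - n)

/-! #### The polynomial `f_m = X (m − X)` -/

/-- `f_m = X (m − X) ∈ ℤ[X]`, whose value at `n` is `n (m − n)`: the binary Goldbach sequence
`{n(m − n)}` as a polynomial sequence for the sieve. [folklore] -/
def pairFormPoly (m : ℕ) : ℤ[X] := X * (C (m : ℤ) - X)

/-- `f_m(n) = n(m − n)`. [cite: Greaves2001, §3.3 (the fundamental lemma applied to a sifted sequence; Corollary 1.1)] -/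
theorem pairFormPoly_eval (m : ℕ) (n : ℤ) : (pairFormPoly m).eval n = n * (m - n) := by
  simp [pairFormPoly]

/-- `ω_{f_m}(p) ≤ 2`: the roots of `n(m − n) ≡ 0 (mod p)` are `0` and `m mod p` (the sieve dimension
of the binary Goldbach problem is `2`). [cite: Greaves2001, §3.3 (the fundamental lemma applied to a sifted sequence; Corollary 1.1)] -/
theorem rootCount_pairFormPoly_le_two (m : ℕ) {p : ℕ} (hp : p.Prime) :
    polyRootCountMod ![pairFormPoly m] p ≤ 2 := by
  rw [polyRootCountMod_single]
  have hsub : (range p).filter (fun s : ℕ => (p : ℤ) ∣ (pairFormPoly m).eval (s : ℤ)) ⊆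
      {0, m % p} := by
    intro s hs
    rw [Finset.mem_filter, Finset.mem_range, pairFormPoly_eval] at hs
    obtain ⟨hsp, hdvd⟩ := hs
    rw [Finset.mem_insert, Finset.mem_singleton]
    have hp' : Prime (p : ℤ) := Nat.prime_iff_prime_int.mp hp
    rcases hp'.dvd_or_dvd hdvd with h | h
    · left
      exact Nat.eq_zero_of_dvd_of_lt (Int.natCast_dvd_natCast.mp h) hsp
    · right
      have hmod : s ≡ m [MOD p] := Nat.modEq_iff_dvd.mpr h
      have : s % p = m % p := hmod
      rwa [Nat.mod_eq_of_lt hsp] at this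
  exact (Finset.card_le_card hsub).trans Finset.card_le_two

/-- `ω_{f_m}(2) ≤ 1` for even `m`: `n(m − n) ≡ n (mod 2)`. [cite: Greaves2001, §3.3 (the fundamental lemma applied to a sifted sequence; Corollary 1.1)] -/
theorem rootCount_pairFormPoly_two_le_one {m : ℕ} (hm : Even m) :
    polyRootCountMod ![pairFormPoly m] 2 ≤ 1 := by
  rw [polyRootCountMod_single, Finset.card_le_one]
  have key : ∀ a : ℕ, a < 2 → (2 : ℤ) ∣ (a : ℤ) * ((m : ℤ) - a) → a = 0 := by
    intro a ha ⟨c, hc⟩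
    obtain ⟨k, hk⟩ := hm
    interval_cases a
    · rfl
    · push_cast at hc
      omega
  intro a ha b hb
  simp only [Finset.mem_filter, Finset.mem_range, pairFormPoly_eval] at ha hb
  rw [key a ha.1 ha.2, key b hb.1 hb.2]

/-- `0 < f_m(n) ≤ m²` for `1 ≤ n ≤ m − 1`. [cite: Greaves2001, §3.3 (the fundamental lemma applied to a sifted sequence; Corollary 1.1)] -/
theorem pairFormPoly_eval_pos (m : ℕ) :
    ∀ n ∈ Ioc 0 (m - 1), 0 < (pairFormPoly m).eval (n : ℤ) ∧
      (((pairFormPoly m).eval (n : ℤ) : ℤ) : ℝ) ≤ (m : ℝ) ^ 2 := by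
  intro n hn
  rw [Finset.mem_Ioc] at hn
  rw [pairFormPoly_eval]
  have h1 : (1 : ℤ) ≤ n := by exact_mod_cast hn.1
  have h2 : (n : ℤ) + 1 ≤ (m : ℤ) := by have := hn.2; omega
  refine ⟨mul_pos (by omega) (by omega), ?_⟩
  push_cast
  have h1' : (1 : ℝ) ≤ n := by exact_mod_cast hn.1
  have h2' : (n : ℝ) + 1 ≤ (m : ℝ) := by exact_mod_cast h2
  nlinarith

/-- `|f_m(n)| = n (m − n)` as natural numbers, `n ≤ m`. [cite: Greaves2001, §3.3 (the fundamental lemma applied to a sifted sequence; Corollary 1.1)] -/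
theorem natAbs_pairFormPoly_eval {m n : ℕ} (hn : n ≤ m) :
    ((pairFormPoly m).eval (n : ℤ)).natAbs = n * (m - n) := by
  rw [pairFormPoly_eval, show (m : ℤ) - n = ((m - n : ℕ) : ℤ) by push_cast [Nat.cast_sub hn]; ring,
    Int.natAbs_mul, Int.natAbs_natCast, Int.natAbs_natCast]

/-! #### `P/φ(P)` for the primorial -/

/-- `P(z)/φ(P(z)) = ∏_{p<z} p/(p − 1)`. [cite: HalberstamRichert1974, Theorem 2.5 (fundamental lemma) and (1.4.14) (the product P/φ(P))] -/
theorem primesProdBelow_div_totient (z : ℝ) :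
    (primesProdBelow z : ℝ) / (Nat.totient (primesProdBelow z) : ℝ) =
      ∏ p ∈ Nat.primesBelow ⌈z⌉₊, ((p : ℝ) / ((p : ℝ) - 1)) := by
  have hsq : Squarefree (primesProdBelow z) := squarefree_primesProdBelow z
  have hpf : (primesProdBelow z).primeFactors = Nat.primesBelow ⌈z⌉₊ :=
    primeFactors_primesProdBelow z
  have h1 : (∏ p ∈ (primesProdBelow z).primeFactors, p) = primesProdBelow z :=
    Nat.prod_primeFactors_of_squarefree hsq
  have h2 := Nat.totient_mul_prod_primeFactors (primesProdBelow z)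
  rw [h1] at h2
  have hP0 : 0 < primesProdBelow z := Nat.pos_of_ne_zero (primesProdBelow_ne_zero z)
  have hφ : Nat.totient (primesProdBelow z) = ∏ p ∈ (primesProdBelow z).primeFactors, (p - 1) := by
    rw [mul_comm] at h2
    exact Nat.eq_of_mul_eq_mul_left hP0 h2
  have hnum : (primesProdBelow z : ℝ) = ∏ p ∈ Nat.primesBelow ⌈z⌉₊, (p : ℝ) := by
    rw [← hpf, ← Nat.cast_prod, h1]
  have hden : (Nat.totient (primesProdBelow z) : ℝ) =
      ∏ p ∈ Nat.primesBelow ⌈z⌉₊, ((p : ℝ) - 1) := by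
    rw [hφ, hpf, Nat.cast_prod]
    refine Finset.prod_congr rfl fun p hp => ?_
    rw [Nat.cast_pred (Nat.prime_of_mem_primesBelow hp).pos]
  rw [hnum, hden, ← Finset.prod_div_distrib]

/-- Telescoping: `∏_{2 ≤ k ≤ K} k/(k − 1) = K` for `K ≥ 1` (private helper). [folklore] -/
private theorem prod_Icc_div_pred (K : ℕ) (hK : 1 ≤ K) :
    ∏ k ∈ Icc 2 K, ((k : ℝ) / ((k : ℝ) - 1)) = K := by
  induction K with
  | zero => omega
  | succ K ih =>
    rcases Nat.lt_or_ge K 1 with hK0 | hK1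
    · interval_cases K
      simp
    · rw [Finset.prod_Icc_succ_top (by omega), ih hK1]
      have hK' : (1 : ℝ) ≤ K := by exact_mod_cast hK1
      have hK0 : (K : ℝ) ≠ 0 := by positivity
      have hK0' : (K : ℝ) + 1 - 1 ≠ 0 := by linarith
      push_cast
      field_simp
      ring

/-- Crude bound `P(z)/φ(P(z)) ≤ z` for `z ≥ 2` (telescoping over all integers `2 ≤ k < ⌈z⌉`). [cite: HalberstamRichert1974, Theorem 2.5 (fundamental lemma) and (1.4.14) (the product P/φ(P))] -/
theorem primesProdBelow_div_totient_le {z : ℝ} (hz : 2 ≤ z) :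
    (primesProdBelow z : ℝ) / (Nat.totient (primesProdBelow z) : ℝ) ≤ z := by
  rw [primesProdBelow_div_totient]
  have hz2 : (2 : ℝ) ≤ (⌈z⌉₊ : ℕ) := hz.trans (Nat.le_ceil z)
  have hK2 : 2 ≤ ⌈z⌉₊ := by exact_mod_cast hz2
  have hsub : Nat.primesBelow ⌈z⌉₊ ⊆ Icc 2 (⌈z⌉₊ - 1) := by
    intro p hp
    have h := Nat.mem_primesBelow.mp hp
    rw [Finset.mem_Icc]
    have := h.2.two_le
    omega
  calc ∏ p ∈ Nat.primesBelow ⌈z⌉₊, ((p : ℝ) / ((p : ℝ) - 1))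
      ≤ ∏ k ∈ Icc 2 (⌈z⌉₊ - 1), ((k : ℝ) / ((k : ℝ) - 1)) := by
        refine Finset.prod_le_prod_of_subset_of_one_le hsub (fun p hp => ?_) (fun k hk _ => ?_)
        · have h2 : (2 : ℝ) ≤ p := by exact_mod_cast (Nat.mem_primesBelow.mp hp).2.two_le
          exact div_nonneg (by linarith) (by linarith)
        · have h2 : (2 : ℝ) ≤ k := by exact_mod_cast (Finset.mem_Icc.mp hk).1
          rw [le_div_iff₀ (by linarith)]
          linarith
    _ = ((⌈z⌉₊ - 1 : ℕ) : ℝ) := prod_Icc_div_pred _ (by omega)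
    _ ≤ z := by
        rw [Nat.cast_sub (by omega)]
        have := Nat.ceil_lt_add_one (by linarith : (0 : ℝ) ≤ z)
        push_cast
        linarith

/-! #### The telescoping lower bound `(P/φ(P))² V(z) ≥ 1/2` -/

/-- `1 − 1/(j − 1)²`, the Euler factor of the twin-prime-type constant `∏_{p ≥ 3}(1 − (p−1)^{−2})`.
[folklore] -/
def telFactor (j : ℕ) : ℝ := 1 - 1 / ((j : ℝ) - 1) ^ 2

/-- `1 − 1/(j−1)² ≥ 0` for `j ≥ 3` (private helper). [folklore] -/
private theorem telFactor_nonneg {j : ℕ} (hj : 3 ≤ j) : 0 ≤ telFactor j := by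
  have h3 : (3 : ℝ) ≤ j := by exact_mod_cast hj
  have h4 : (4 : ℝ) ≤ ((j : ℝ) - 1) ^ 2 := by nlinarith
  unfold telFactor
  rw [sub_nonneg, div_le_one (by positivity)]
  linarith

/-- `1 − 1/(j−1)² ≤ 1` (private helper). [folklore] -/
private theorem telFactor_le_one (j : ℕ) : telFactor j ≤ 1 := by
  unfold telFactor
  have : 0 ≤ 1 / ((j : ℝ) - 1) ^ 2 := by positivity
  linarith

/-- Telescoping: `∏_{3 ≤ j ≤ M} (1 − 1/(j − 1)²) = M/(2(M − 1))` for `M ≥ 2` (private helper). [folklore] -/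
private theorem prod_Icc_telFactor (M : ℕ) (hM : 2 ≤ M) :
    ∏ j ∈ Icc 3 M, telFactor j = (M : ℝ) / (2 * ((M : ℝ) - 1)) := by
  induction M with
  | zero => omega
  | succ M ih =>
    rcases Nat.lt_or_ge M 2 with hM0 | hM2
    · have hM1 : M = 1 := by omega
      subst hM1
      rw [Finset.Icc_eq_empty_of_lt (by norm_num), Finset.prod_empty]
      norm_num
    · rw [Finset.prod_Icc_succ_top (by omega), ih hM2]
      have hM' : (2 : ℝ) ≤ M := by exact_mod_cast hM2
      have h1 : (M : ℝ) - 1 ≠ 0 := by linarith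
      have h2 : (M : ℝ) ≠ 0 := by linarith
      unfold telFactor
      push_cast
      have h3 : (M : ℝ) + 1 - 1 = M := by ring
      rw [h3]
      field_simp
      ring

/-- `∏_{3 ≤ j ≤ M} (1 − 1/(j − 1)²) ≥ 1/2` (private helper). [folklore] -/
private theorem half_le_prod_Icc_telFactor (M : ℕ) : (1 : ℝ) / 2 ≤ ∏ j ∈ Icc 3 M, telFactor j := by
  rcases Nat.lt_or_ge M 2 with hM | hM
  · rw [Finset.Icc_eq_empty_of_lt (by omega), Finset.prod_empty]
    norm_num
  · rw [prod_Icc_telFactor M hM]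
    have hM' : (2 : ℝ) ≤ M := by exact_mod_cast hM
    rw [div_le_div_iff₀ (by norm_num) (by linarith)]
    linarith

/-- **`(P(z)/φ(P(z)))² · V_f(z) ≥ 1/2`** when `ω_f(2) ≤ 1`, `ω_f(p) ≤ 2`: termwise
`(p/(p−1))²(1 − ω(p)/p) ≥ 1 − 1/(p−1)²` (`p ≥ 3`), `≥ 1` (`p = 2`), then telescoping — the
truncated singular series of the binary problem is bounded below. [cite: HalberstamRichert1974, Theorem 2.5 (fundamental lemma) and (1.4.14) (the product P/φ(P))] -/
theorem half_le_sq_mul_prod {f : ℤ[X]} (h2 : polyRootCountMod ![f] 2 ≤ 1)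
    (hle : ∀ p : ℕ, p.Prime → polyRootCountMod ![f] p ≤ 2) (z : ℝ) :
    (1 : ℝ) / 2 ≤ (∏ p ∈ Nat.primesBelow ⌈z⌉₊, ((p : ℝ) / ((p : ℝ) - 1))) ^ 2 *
      ∏ p ∈ Nat.primesBelow ⌈z⌉₊, (1 - (polyRootCountMod ![f] p : ℝ) / p) := by
  rw [← Finset.prod_pow, ← Finset.prod_mul_distrib]
  have hterm : ∀ p ∈ Nat.primesBelow ⌈z⌉₊, (if p ≠ 2 then telFactor p else 1) ≤
      ((p : ℝ) / ((p : ℝ) - 1)) ^ 2 * (1 - (polyRootCountMod ![f] p : ℝ) / p) := by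
    intro p hp
    have hpp : p.Prime := (Nat.mem_primesBelow.mp hp).2
    by_cases hp2 : p = 2
    · subst hp2
      rw [if_neg (by simp)]
      have : (polyRootCountMod ![f] 2 : ℝ) ≤ 1 := by exact_mod_cast h2
      push_cast
      nlinarith
    · rw [if_pos hp2]
      have hp3 : (3 : ℝ) ≤ p := by exact_mod_cast (by have := hpp.two_le; omega : 3 ≤ p)
      have hω : (polyRootCountMod ![f] p : ℝ) ≤ 2 := by exact_mod_cast hle p hpp
      have hp1 : (0 : ℝ) < (p : ℝ) - 1 := by linarith
      have hp0 : (0 : ℝ) < p := by linarith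
      unfold telFactor
      rw [show (1 : ℝ) - 1 / ((p : ℝ) - 1) ^ 2 = (p : ℝ) * ((p : ℝ) - 2) / ((p : ℝ) - 1) ^ 2 by
        field_simp; ring]
      rw [show ((p : ℝ) / ((p : ℝ) - 1)) ^ 2 * (1 - (polyRootCountMod ![f] p : ℝ) / p) =
        (p : ℝ) * ((p : ℝ) - polyRootCountMod ![f] p) / ((p : ℝ) - 1) ^ 2 by
        field_simp]
      apply div_le_div_of_nonneg_right _ (by positivity)
      nlinarith
  have h0 : ∀ p ∈ Nat.primesBelow ⌈z⌉₊, 0 ≤ (if p ≠ 2 then telFactor p else 1 : ℝ) := by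
    intro p hp
    split_ifs with hp2
    · exact telFactor_nonneg (by have := (Nat.mem_primesBelow.mp hp).2.two_le; omega)
    · norm_num
  refine le_trans ?_ (Finset.prod_le_prod h0 hterm)
  rw [← Finset.prod_filter]
  have hsub : (Nat.primesBelow ⌈z⌉₊).filter (fun p => p ≠ 2) ⊆ Icc 3 ⌈z⌉₊ := by
    intro p hp
    rw [Finset.mem_filter] at hp
    have h := Nat.mem_primesBelow.mp hp.1
    rw [Finset.mem_Icc]
    have := h.2.two_le
    omega
  refine le_trans (half_le_prod_Icc_telFactor ⌈z⌉₊)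
    (Finset.prod_le_prod_of_subset_of_le_one hsub (fun j hj => telFactor_nonneg (Finset.mem_Icc.mp hj).1)
      fun j _ _ => telFactor_le_one j)

/-! #### The count identity -/

/-- `g_z(a) g_z(b) = (P/φ(P))² · 1[(ab, P) = 1]` (private helper). [folklore] -/
private theorem roughModel_mul_roughModel (B : ℝ) (N a b : ℕ) :
    roughModel B N a * roughModel B N b =
      if (a * b).Coprime (roughPrimorial B N) then
        ((roughPrimorial B N : ℝ) / (Nat.totient (roughPrimorial B N) : ℝ)) ^ 2 else 0 := by
  have key : (a * b).Coprime (roughPrimorial B N) ↔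
      a.Coprime (roughPrimorial B N) ∧ b.Coprime (roughPrimorial B N) := Nat.coprime_mul_iff_left
  unfold roughModel
  by_cases h1 : a.Coprime (roughPrimorial B N) <;> by_cases h2 : b.Coprime (roughPrimorial B N)
  · rw [if_pos h1, if_pos h2, if_pos (key.mpr ⟨h1, h2⟩), sq]
  · rw [if_pos h1, if_neg h2, if_neg (fun h => h2 (key.mp h).2), mul_zero]
  · rw [if_neg h1, if_neg (fun h => h1 (key.mp h).1), zero_mul]
  · rw [if_neg h1, if_neg (fun h => h1 (key.mp h).1), zero_mul]

/-- `∑_{1 ≤ n ≤ m−1} g(n) g(m − n) = (P/φ(P))² · #{1 ≤ n ≤ m − 1 : (n(m − n), P) = 1}`: the rough-model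
pair sum IS a sifted count of the sequence `n(m − n)`. [cite: Greaves2001, §3.3 (the fundamental lemma applied to a sifted sequence; Corollary 1.1)] -/
theorem pairSum_eq (B : ℝ) (N m : ℕ) :
    ∑ n ∈ Icc 1 (m - 1), roughModel B N n * roughModel B N (m - n) =
      ((roughPrimorial B N : ℝ) / (Nat.totient (roughPrimorial B N) : ℝ)) ^ 2 *
        (#((Icc 1 (m - 1)).filter fun n : ℕ => (n * (m - n)).Coprime (roughPrimorial B N)) : ℝ) := by
  rw [Finset.sum_congr rfl fun n _ => roughModel_mul_roughModel B N n (m - n), Finset.sum_ite,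
    Finset.sum_const_zero, add_zero, Finset.sum_const, nsmul_eq_mul, mul_comm]

/-- The sifted set written through `pairFormPoly` (private helper). [folklore] -/
private theorem filter_Icc_eq_filter_Ioc (P m : ℕ) :
    (Icc 1 (m - 1)).filter (fun n : ℕ => (n * (m - n)).Coprime P) =
      (Ioc 0 (m - 1)).filter fun n : ℕ => ((pairFormPoly m).eval (n : ℤ)).natAbs.Coprime P := by
  ext n
  simp only [Finset.mem_filter, Finset.mem_Icc, Finset.mem_Ioc]
  constructor
  · rintro ⟨⟨h1, h2⟩, h3⟩
    exact ⟨⟨h1, h2⟩, by rwa [natAbs_pairFormPoly_eval (by omega)]⟩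
  · rintro ⟨⟨h1, h2⟩, h3⟩
    exact ⟨⟨h1, h2⟩, by rwa [natAbs_pairFormPoly_eval (by omega)] at h3⟩

/-! #### E6 -/

/-- **The rough-model pair count holds** (`c₀ = 1/16`): the two-sided fundamental lemma for the
polynomial sequence `n(m − n)` (tree: `abs_card_coprime_sub_le`), dimension `2`, `z = (log N)^B`,
`D = z^{s₀}` with a constant `s₀` making the fundamental-lemma factor `≤ 1/2`, the bounds
`(P/φ(P))² V(z) ≥ 1/2`, `P/φ(P) ≤ z`, and `(log N)^{B(s₀+4)} = o(N)`. [cite: Greaves2001, §3.3 (the fundamental lemma applied to a sifted sequence; Corollary 1.1)] -/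
theorem roughModelPairCountLower_holds : RoughModelPairCountLower := by
  intro B hB
  refine ⟨1 / 16, by norm_num, ?_⟩
  -- the Fundamental-Lemma constant `Cω` and the (constant) sifting parameter `s₀`
  set Cω : ℝ := SieveSequence.flConst 2 (2 * Real.exp (17 + 12 / Real.log 2)) with hCω
  have hCω0 : 0 < Cω := SieveSequence.flConst_pos (by norm_num) (by positivity)
  set s₀ : ℝ := 1 + max 0 (Real.log (2 * Cω)) with hs₀
  have hs₀1 : 1 ≤ s₀ := by have := le_max_left 0 (Real.log (2 * Cω)); linarith
  have hs₀0 : 0 < s₀ := by linarith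
  have hCωexp : Cω * Real.exp (-s₀) ≤ 1 / 2 := by
    have h1 : Real.exp (-s₀) ≤ Real.exp (-Real.log (2 * Cω)) := by
      apply Real.exp_le_exp.mpr
      have := le_max_right 0 (Real.log (2 * Cω))
      linarith
    rw [Real.exp_neg (Real.log (2 * Cω)), Real.exp_log (by positivity)] at h1
    calc Cω * Real.exp (-s₀) ≤ Cω * (2 * Cω)⁻¹ := by gcongr
      _ = 1 / 2 := by field_simp
  -- eventual conditions in the real variable `x`, then `N₀`
  have hev₁ : ∀ᶠ x : ℝ in atTop, 2 ≤ Real.log x ^ B :=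
    ((tendsto_rpow_atTop hB).comp Real.tendsto_log_atTop).eventually_ge_atTop 2
  have hev₂ : ∀ᶠ x : ℝ in atTop, ‖Real.log x ^ (B * (s₀ + 4))‖ ≤
      (1 / (64 * Real.exp 8)) * ‖x ^ (1 : ℝ)‖ :=
    (isLittleO_log_rpow_rpow_atTop (B * (s₀ + 4)) one_pos).bound (by positivity)
  have hev₃ : ∀ᶠ x : ℝ in atTop, 4 ≤ x := eventually_ge_atTop 4
  obtain ⟨X₀, hX₀⟩ := Filter.eventually_atTop.mp (hev₁.and (hev₂.and hev₃))
  refine ⟨⌈X₀⌉₊, fun N hN m hm hNm hmN => ?_⟩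
  obtain ⟨hz2, hE, hN4⟩ := hX₀ N (Nat.ceil_le.mp hN)
  -- `z`, `P`, `r = P/φ(P)`
  set z : ℝ := roughLevel B N with hz
  change 2 ≤ z at hz2
  have hz0 : 0 < z := by linarith
  have hP : roughPrimorial B N = primesProdBelow z := rfl
  have hlogN0 : 0 ≤ Real.log N := Real.log_nonneg (by linarith)
  -- `m ≥ 2`
  have hm1 : (1 : ℝ) ≤ m := by linarith
  have hm2 : 2 ≤ m := by
    have h1 : 1 ≤ m := by exact_mod_cast hm1
    obtain ⟨k, hk⟩ := hm
    omega
  have hm2' : (2 : ℝ) ≤ m := by exact_mod_cast hm2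
  have hX : ((m - 1 : ℕ) : ℝ) = (m : ℝ) - 1 := by
    rw [Nat.cast_sub (by omega)]; push_cast; ring
  -- the polynomial `f_m`
  have h2f := rootCount_pairFormPoly_two_le_one hm
  have hlef : ∀ p : ℕ, p.Prime → polyRootCountMod ![pairFormPoly m] p ≤ 2 :=
    fun p hp => rootCount_pairFormPoly_le_two m hp
  -- `D = z^{s₀}`
  have hzD : z ≤ z ^ s₀ := by
    calc z = z ^ (1 : ℝ) := (Real.rpow_one z).symm
      _ ≤ z ^ s₀ := Real.rpow_le_rpow_of_exponent_le (by linarith) hs₀1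
  have hD : Real.log (z ^ s₀) / Real.log z = s₀ := by
    rw [Real.log_rpow hz0, mul_div_assoc, div_self (Real.log_pos (by linarith)).ne', mul_one]
  -- the two-sided Fundamental Lemma for `{n(m − n) : 1 ≤ n ≤ m − 1}`
  have hFL := abs_card_coprime_sub_le h2f hlef (N := m - 1) (x := (m : ℝ) ^ 2) hz2 hzD
    (pairFormPoly_eval_pos m)
  rw [← hCω, hD, hX] at hFL
  set V : ℝ := ∏ p ∈ Nat.primesBelow ⌈z⌉₊, (1 - (polyRootCountMod ![pairFormPoly m] p : ℝ) / p)
    with hV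
  set Sc : ℝ := (#((Ioc 0 (m - 1)).filter fun n : ℕ =>
    ((pairFormPoly m).eval (n : ℤ)).natAbs.Coprime (primesProdBelow z)) : ℝ) with hSc
  have hV0 : 0 < V := prod_one_sub_rootCount_pos h2f hlef z
  set r : ℝ := (primesProdBelow z : ℝ) / (Nat.totient (primesProdBelow z) : ℝ) with hr
  have hr0 : 0 ≤ r := by positivity
  have hrz : r ≤ z := primesProdBelow_div_totient_le hz2
  have hrV : 1 / 2 ≤ r ^ 2 * V := by
    rw [hr, primesProdBelow_div_totient]
    exact half_le_sq_mul_prod h2f hlef z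
  -- rewrite the goal as `m/16 ≤ r² Sc`
  rw [pairSum_eq, filter_Icc_eq_filter_Ioc, hP]
  change 1 / 16 * (m : ℝ) ≤ r ^ 2 * Sc
  -- lower bound for `Sc` from the Fundamental Lemma
  set E : ℝ := z ^ s₀ * (Real.exp 8 * Real.log z ^ 2) with hEdef
  have hXV : 0 ≤ ((m : ℝ) - 1) * V := by positivity
  have hSc : ((m : ℝ) - 1) * V / 2 - E ≤ Sc := by
    have h1 := (abs_le.mp hFL).1
    have h2 : Cω * ((m : ℝ) - 1) * V * Real.exp (-s₀) ≤ ((m : ℝ) - 1) * V / 2 := by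
      have := mul_le_mul_of_nonneg_left hCωexp hXV
      linarith [this]
    linarith
  -- multiply by `r²` and use `r² V ≥ 1/2`
  have hmain : ((m : ℝ) - 1) / 4 - r ^ 2 * E ≤ r ^ 2 * Sc := by
    have h1 : r ^ 2 * (((m : ℝ) - 1) * V / 2 - E) ≤ r ^ 2 * Sc :=
      mul_le_mul_of_nonneg_left hSc (by positivity)
    have h2 : ((m : ℝ) - 1) / 4 ≤ r ^ 2 * (((m : ℝ) - 1) * V / 2) := by
      have := mul_le_mul_of_nonneg_left hrV (by linarith : (0 : ℝ) ≤ (m : ℝ) - 1)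
      linarith
    nlinarith
  -- the error term: `r² E ≤ e⁸ z^{s₀+4} = e⁸ (log N)^{B(s₀+4)} ≤ N/64 ≤ m/16`
  have hlogz : Real.log z ^ 2 ≤ z ^ 2 := by
    have h0 : 0 ≤ Real.log z := Real.log_nonneg (by linarith)
    have h1 : Real.log z ≤ z := Real.log_le_self hz0.le
    nlinarith
  have hpow : z ^ s₀ * z ^ 4 = Real.log N ^ (B * (s₀ + 4)) := by
    have h4 : z ^ (4 : ℕ) = z ^ (4 : ℝ) := by
      rw [← Real.rpow_natCast]; norm_num
    rw [h4, ← Real.rpow_add hz0, Real.rpow_mul hlogN0]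
    rfl
  have hE' : Real.log N ^ (B * (s₀ + 4)) ≤ (1 / (64 * Real.exp 8)) * N := by
    have h := hE
    rw [Real.norm_of_nonneg (Real.rpow_nonneg hlogN0 _), Real.rpow_one,
      Real.norm_of_nonneg (by positivity)] at h
    exact h
  have hErr : r ^ 2 * E ≤ (m : ℝ) / 16 := by
    have h1 : r ^ 2 ≤ z ^ 2 := pow_le_pow_left₀ hr0 hrz 2
    have h2 : E ≤ z ^ s₀ * (Real.exp 8 * z ^ 2) := by
      rw [hEdef]
      gcongr
    have hE0 : 0 ≤ E := by positivity
    calc r ^ 2 * E ≤ z ^ 2 * (z ^ s₀ * (Real.exp 8 * z ^ 2)) := by gcongr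
      _ = Real.exp 8 * (z ^ s₀ * z ^ 4) := by ring
      _ = Real.exp 8 * Real.log N ^ (B * (s₀ + 4)) := by rw [hpow]
      _ ≤ Real.exp 8 * ((1 / (64 * Real.exp 8)) * N) := by gcongr
      _ = (N : ℝ) / 64 := by field_simp
      _ ≤ (m : ℝ) / 16 := by linarith
  linarith

end Literature.NumberTheory.Sieve.CubicMinorant

end
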